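import Mathlib.LinearAlgebra.Charpoly.ToMatrix
import Mathlib.LinearAlgebra.Matrix.Charpoly.Coeff
import Mathlib.RingTheory.Polynomial.ScaleRoots
import Literature.NumberTheory.Automorphic.ReciprocityGLn
import Literature.NumberTheory.GaloisRepresentations.GaloisRep
import Literature.RepresentationTheory.Semisimple.Twist
import HarnessLib

/-!
# A Galois self-twist `ρ ≅ ρ ⊗ χ` makes the Satake multiset `χ(Frob_v)`-stable

Local dictionary for the Satake-level form of the base-change ascent operator of the crux
`IrreducibleOffSector` (stmt-Langlands-14329,
`Summit.Langlands.Langlands.Theses.IrreducibilityBySelfDuality.IrreducibleOffSector`, route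
`Langlands/IrreducibilityBySelfDuality`, line `Sketch`, lead c7, BC-ascent package, stub W6).

For `L/K` cyclic, an irreducible `ℓ`-adic avatar `ρ₀` of a cuspidal `π` restricts irreducibly to
`Γ_L` unless `ρ₀ ≅ ρ₀ ⊗ χ` for a non-trivial character `χ` of `Gal(L/K)` (Clifford).  To turn
"no Galois self-twist" into an *automorphic* hypothesis one reads a self-twist off the Satake
parameters: if `ρ ≅ ρ ⊗ χ` and the characteristic polynomial of an arithmetic Frobenius `σ` at
`v` is `∏_{a ∈ α} (X - ι⁻¹(a⁻¹))` (`arithFrobPolyOfSatake ι q_v 1 α`, `α` the Satake multiset of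
`π` at `v` in the L-normalisation), then `α` is invariant under multiplication by
`ι(χ(σ))⁻¹`.

* `Summit.Langlands.Langlands.Theorems.IrreducibleOffSector.charpoly_smul_eq_scaleRoots` — for a
  square matrix `M` over an infinite field and `c ≠ 0`, `(c • M).charpoly = M.charpoly.scaleRoots c`;
* `Summit.Langlands.Langlands.Theorems.IrreducibleOffSector.satake_map_mul_eq_of_equiv_twist` —
  the statement above.

Proof.  Write `c := χ(σ)` and `M := ρ(σ)`.  (1) The intertwiner `e` conjugates `ρ(σ)` into
`(ρ ⊗ χ)(σ) = c • ρ(σ)` (`Representation.Equiv.conj_apply_self`), so `M` and `c • M` have the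
same characteristic polynomial (`LinearEquiv.charpoly_conj`, `Matrix.charpoly_toLin'`).  (2)
`(c • M).charpoly = M.charpoly.scaleRoots c`, by comparing values at `c * r`:
`det (c r - c M) = c ^ n det (r - M)` (`Matrix.det_smul`) against
`Polynomial.scaleRoots_eval_mul`.  (3) Hence `P = P.scaleRoots c` for `P := M.charpoly =
∏_{a ∈ α} (X - ι⁻¹(a⁻¹))`, so the root multiset `{ι⁻¹(a⁻¹)}` is stable under `c * ·`
(`Polynomial.roots_scaleRoots`, `roots_arithFrobPolyOfSatake`); pulling back along the injection
`a ↦ ι⁻¹(a⁻¹)` gives `{ι(c)⁻¹ a} = {a}`.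

References: folklore (characteristic polynomials of conjugate and of rescaled matrices); for the
context, A. H. Clifford, Ann. of Math. 38 (1937), Thm. 1, and J. Arthur–L. Clozel, *Simple
algebras, base change, and the advanced theory of the trace formula* (1989), Ch. 3, Thm. 4.2.
-/

noncomputable section

-- `Summit.Langlands.Langlands.…` (summit = sub-problem name, D-0017 layout) trips `dupNamespace`
set_option linter.dupNamespace false

open scoped NumberField
open IsDedekindDomain
open Literature.RepresentationTheory.Semisimple
open Literature.NumberTheory.Automorphic Literature.NumberTheory.GaloisRepresentations Field

namespace Summit.Langlands.Langlands.Theorems.IrreducibleOffSector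

/-- **Characteristic polynomial of a rescaled matrix.**  For a square matrix `M` over an infinite
field and a scalar `c ≠ 0`, the characteristic polynomial of `c • M` is `M.charpoly` with its
roots scaled by `c`: `det (X - c M) = c ^ n · det (X / c - M)`.  (Checked on values: at `c * r`
both sides evaluate to `c ^ n det (r - M)`, by `Matrix.det_smul` and
`Polynomial.scaleRoots_eval_mul`; an infinite field separates polynomials by their values.)
[folklore] -/
theorem charpoly_smul_eq_scaleRoots {F : Type*} [Field F] [Infinite F] {m : Type*} [Fintype m]
    [DecidableEq m] {c : F} (hc : c ≠ 0) (M : Matrix m m F) :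
    (c • M).charpoly = M.charpoly.scaleRoots c := by
  refine Polynomial.funext fun t => ?_
  obtain ⟨r, rfl⟩ : ∃ r, t = c * r := ⟨c⁻¹ * t, (mul_inv_cancel_left₀ hc t).symm⟩
  rw [Polynomial.scaleRoots_eval_mul, Matrix.charpoly_natDegree_eq_dim, Matrix.eval_charpoly,
    Matrix.eval_charpoly, ← Matrix.det_smul]
  congr 1
  ext i j
  rcases eq_or_ne i j with rfl | hij
  · simp [Matrix.scalar_apply, mul_sub]
  · simp [Matrix.scalar_apply, hij]

/-- **A Galois self-twist makes the Satake multiset `χ(Frob)`-stable.**  Let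
`ρ : Γ_K → GL_n(ℚ̄_ℓ)` be a framed Galois representation with `ρ ≅ ρ ⊗ χ` for a character
`χ : Γ_K → ℚ̄_ℓˣ`, and suppose that at the finite place `v` the arithmetic Frobenii of `ρ` have
characteristic polynomial `∏_{a ∈ α} (X - ι⁻¹(a⁻¹))` (`arithFrobPolyOfSatake ι q_v 1 α`).  Then
for every arithmetic Frobenius `σ` at a prime `𝔓 ∣ v`, the multiset `α` is invariant under
multiplication by `ι(χ(σ))⁻¹`.  (Conjugate endomorphisms `ρ(σ)` and `χ(σ) ρ(σ)` have the same
characteristic polynomial, whose root multiset `{ι⁻¹(a⁻¹)}` is therefore stable under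
multiplication by `χ(σ)`.) [folklore] -/
theorem satake_map_mul_eq_of_equiv_twist {K : Type} [Field K] [NumberField K] {ℓ : ℕ}
    [Fact ℓ.Prime] {n : ℕ} (ι : PadicAlgCl ℓ ≃+* ℂ) (ρ : FramedGaloisRep K (PadicAlgCl ℓ) n)
    (χ : absoluteGaloisGroup K →* (PadicAlgCl ℓ)ˣ)
    (e : (FramedRep.toRepresentation ρ).Equiv
      (Representation.twist (FramedRep.toRepresentation ρ) χ))
    {v : HeightOneSpectrum (𝓞 K)} {α : Multiset ℂ}
    (hρ : ρ.HasFrobCharpolyAt v (arithFrobPolyOfSatake ι v.residueCard 1 α))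
    {𝔓 : Ideal (absIntegers (𝓞 K) K)} (h𝔓 : 𝔓 ∈ v.primesAbove) {σ : absoluteGaloisGroup K}
    (hσ : IsArithFrobAt (𝓞 K) σ 𝔓) :
    α.map (fun a => (ι (χ σ : PadicAlgCl ℓ))⁻¹ * a) = α := by
  set c : PadicAlgCl ℓ := (χ σ : PadicAlgCl ℓ) with hc_def
  have hc : c ≠ 0 := (χ σ).ne_zero
  set M : Matrix (Fin n) (Fin n) (PadicAlgCl ℓ) :=
    ((ρ σ : GL (Fin n) (PadicAlgCl ℓ)) : Matrix (Fin n) (Fin n) (PadicAlgCl ℓ)) with hM_def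
  -- (1) conjugacy: `ρ σ` and `(ρ ⊗ χ) σ = c • ρ σ` have the same characteristic polynomial
  have hM : (FramedRep.toRepresentation ρ σ :
      (Fin n → PadicAlgCl ℓ) →ₗ[PadicAlgCl ℓ] (Fin n → PadicAlgCl ℓ)) = Matrix.toLin' M :=
    LinearMap.ext fun w => by simp [M]
  have hcM : (Representation.twist (FramedRep.toRepresentation ρ) χ σ :
      (Fin n → PadicAlgCl ℓ) →ₗ[PadicAlgCl ℓ] (Fin n → PadicAlgCl ℓ)) = Matrix.toLin' (c • M) :=
    LinearMap.ext fun w => by simp [M, c]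
  have h1 : (c • M).charpoly = M.charpoly := by
    rw [← Matrix.charpoly_toLin', ← Matrix.charpoly_toLin', ← hM, ← hcM,
      ← Representation.Equiv.conj_apply_self σ e, LinearEquiv.charpoly_conj]
  -- (2) the Frobenius polynomial `P` satisfies `P = P.scaleRoots c`
  have hP : M.charpoly = arithFrobPolyOfSatake ι v.residueCard 1 α := hρ 𝔓 h𝔓 σ hσ
  have h2 : arithFrobPolyOfSatake ι v.residueCard 1 α =
      (arithFrobPolyOfSatake ι v.residueCard 1 α).scaleRoots c := by
    rw [← hP, ← charpoly_smul_eq_scaleRoots hc, h1]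
  -- (3) compare root multisets and pull back along the injection `a ↦ ι⁻¹ (a⁻¹)`
  have h3 := congrArg Polynomial.roots h2
  rw [Polynomial.roots_scaleRoots _ (Ne.isUnit hc), roots_arithFrobPolyOfSatake] at h3
  simp only [Nat.sub_self, pow_zero, one_mul, Multiset.map_map, Function.comp_def] at h3
  have hinj : Function.Injective fun a : ℂ => ι.symm a⁻¹ := ι.symm.injective.comp inv_injective
  apply Multiset.map_injective hinj
  rw [Multiset.map_map, h3]
  refine Multiset.map_congr rfl fun a _ => ?_
  simp only [Function.comp_apply, mul_inv, inv_inv, map_mul, RingEquiv.symm_apply_apply]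

end Summit.Langlands.Langlands.Theorems.IrreducibleOffSector

end
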